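import Literature.InformationTheory.Entanglement.TwoRebitSeparabilityProbability
import Mathlib.MeasureTheory.Measure.Lebesgue.EqHaar
import Mathlib.MeasureTheory.Constructions.Pi
import Mathlib.Topology.Instances.Matrix
import HarnessLib

/-!
# Two-rebit separability probability on a fibre: Fubini over the diagonal block and the slices

Second step of the proof of Lovas–Andai 2017, Theorem 1/2 on the fibre over `D = 𝟙`
(`LovasAndai2017_rebit_fibre_2964_iff_one`): the `7`-dimensional bodies
`D_ℝ(𝟙) = {(X, Z) | [[X, Z], [Zᵀ, 𝟙 − X]] ≽ 0}` and `P_ℝ(𝟙)` are integrated "`X` first":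

* `volume_rebitFibreBody_one_eq_lintegral` : `λ₇(D_ℝ(𝟙)) = ∫⁻ a, λ₄(S(a))`, where
  `S(a) = rebitSlice a` is the `Z`-slice over the symmetric block `X(a) = [[a0, a2], [a2, a1]]`
  (and the same for the PPT body with `rebitPPTSlice`) — Lovas–Andai's first display in the
  proof of Theorem 1 ("By Fubini's theorem …").
* The operator-norm unit ball `𝔹 = rebitOpBall = {K | 𝟙 − KᵀK ≽ 0}` of real `2 × 2` matrices
  (Lovas–Andai's `𝔹_ℝ`, Lemma 3) and the "defect" bodies
  `rebitDefectBall ε = {K ∈ 𝔹 | (V_ε⁻¹ K V_ε)ᵀ ∈ 𝔹}`, `V_ε = diag(1, ε)`, whose volume is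
  Lovas–Andai's `χ₁(ε)` (Definition 1; `𝔹` is transpose invariant).
* `volume_rebitSlice_diag`, `volume_rebitPPTSlice_diag` : over a DIAGONAL block
  `X = diag(l, m)`, `0 < l, m < 1`, the slices are the images of `𝔹`, resp. of the defect body
  with `ε = √(l(1−m)) / √(m(1−l))`, under the diagonal scaling
  `k_ij ↦ √(lᵢ(1 − lⱼ)) k_ij` (Lovas–Andai's substitution `C = D₁^{1/2} X D₂^{1/2}` with
  `D₁ = Λ`, `D₂ = 𝟙 − Λ`), so `λ₄(S) = l m (1−l)(1−m) · λ₄(𝔹)` and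
  `λ₄(S^Γ) = l m (1−l)(1−m) · λ₄(rebitDefectBall ε)`.

The block factorisation behind the last item is written with explicit `4 × 4` matrices:
`[[Λ, AKB], [(AKB)ᵀ, 𝟙 − Λ]] = (A ⊕ B) [[𝟙, K], [Kᵀ, 𝟙]] (A ⊕ B)` for `A = Λ^{1/2}`,
`B = (𝟙 − Λ)^{1/2}`, and `[[𝟙, K], [Kᵀ, 𝟙]] ≽ 0 ↔ 𝟙 − KᵀK ≽ 0` is the Schur complement
(Lovas–Andai Lemma 1; Mathlib `Matrix.PosDef.fromBlocks₁₁`).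

## Not here

The reduction of a general block `X(a)` to a diagonal one by a rotation and the polar /
eigenvalue coordinates on `a ∈ ℝ³` (next file), the value `λ₄(𝔹) = 2π²/3`, Lemma 6 and the
final integral of Theorem 2.

## References

* [LovasAndai2017] A. Lovas, A. Andai, Invariance of separability probability over reduced states
  in 4 × 4 bipartite systems, J. Phys. A 50 (2017) 295303, §2 (Lemmas 1, 3, Definition 1),
  §3 (proof of Theorem 1).
-/

noncomputable section

open MeasureTheory Set
open scoped ENNReal Matrix

namespace Literature.InformationTheory.Entanglement

/-! ### Coordinates `(a, k) ↦ x`: the symmetric block `X(a)` and the matrix `Z(k)` -/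

/-- Joining the block coordinates `a = (x0, x1, x2)` of `X` and `k = (z00, z01, z10, z11)` of
`Z` into the chart coordinate `x ∈ ℝ⁷` of `rebitFibreDensity`. [folklore] -/
def rebitJoin (a : Fin 3 → ℝ) (k : Fin 4 → ℝ) : Fin 7 → ℝ :=
  ![a 0, a 1, a 2, k 0, k 1, k 2, k 3]

/-- The `2 × 2` real matrix with row-major coordinates `k`. [folklore] -/
def matZ (k : Fin 4 → ℝ) : Matrix (Fin 2) (Fin 2) ℝ :=
  !![k 0, k 1; k 2, k 3]

/-- The density over `𝟙` in block coordinates: `[[X(a), Z(k)], [Z(k)ᵀ, 𝟙 − X(a)]]`.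
[cite: LovasAndai2017, §3 (ρ(D₁, D₂, C))] -/
theorem rebitFibreDensity_one_rebitJoin (a : Fin 3 → ℝ) (k : Fin 4 → ℝ) :
    rebitFibreDensity 1 (rebitJoin a k) =
      !![a 0, a 2, k 0, k 1; a 2, a 1, k 2, k 3; k 0, k 2, 1 - a 0, -a 2;
        k 1, k 3, -a 2, 1 - a 1] := by
  ext i j
  fin_cases i <;> fin_cases j <;> simp [rebitFibreDensity, rebitJoin]

/-- The partial transpose over `𝟙` in block coordinates: `[[X(a), Z(k)ᵀ], [Z(k), 𝟙 − X(a)]]`.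
[cite: LovasAndai2017, §3 (the involution T)] -/
theorem rebitFibreDensityPT_one_rebitJoin (a : Fin 3 → ℝ) (k : Fin 4 → ℝ) :
    rebitFibreDensityPT 1 (rebitJoin a k) =
      !![a 0, a 2, k 0, k 2; a 2, a 1, k 1, k 3; k 0, k 1, 1 - a 0, -a 2;
        k 2, k 3, -a 2, 1 - a 1] := by
  ext i j
  fin_cases i <;> fin_cases j <;> simp [rebitFibreDensityPT, rebitJoin]

/-- The `Z`-slice of the state body over `𝟙` at the block `X(a)`:
`S(a) = {Z | [[X(a), Z], [Zᵀ, 𝟙 − X(a)]] ≽ 0}` (Lovas–Andai's inner integration domain, without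
the PPT condition). [cite: LovasAndai2017, §3 (proof of Theorem 1, the set 𝒞(D₁, D₂))] -/
def rebitSlice (a : Fin 3 → ℝ) : Set (Fin 4 → ℝ) :=
  {k | rebitJoin a k ∈ rebitFibreBody (1 : Matrix (Fin 2) (Fin 2) ℝ)}

/-- The `Z`-slice of the PPT body over `𝟙` at the block `X(a)`: Lovas–Andai's
`𝒞(D₁, D₂) = {C | ρ(D₁, D₂, C) ≽ 0, ρ(D₁, D₂, C*) ≽ 0}` with `D₁ = X(a)`, `D₂ = 𝟙 − X(a)`
(closed version). [cite: LovasAndai2017, §3 (proof of Theorem 1, the set 𝒞(D₁, D₂))] -/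
def rebitPPTSlice (a : Fin 3 → ℝ) : Set (Fin 4 → ℝ) :=
  {k | rebitJoin a k ∈ rebitFibrePPTBody (1 : Matrix (Fin 2) (Fin 2) ℝ)}

/-- `S^Γ(a) ⊆ S(a)`. [cite: LovasAndai2017, §3] -/
theorem rebitPPTSlice_subset (a : Fin 3 → ℝ) : rebitPPTSlice a ⊆ rebitSlice a :=
  fun _ h => h.1

/-! ### Closedness and measurability of the bodies -/

/-- The set of positive semidefinite real `4 × 4` matrices is closed. [folklore] -/
theorem isClosed_setOf_posSemidef_fin_four :
    IsClosed {M : Matrix (Fin 4) (Fin 4) ℝ | M.PosSemidef} := by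
  have h : {M : Matrix (Fin 4) (Fin 4) ℝ | M.PosSemidef} =
      {M | Mᴴ = M} ∩ ⋂ v : Fin 4 → ℝ, {M | 0 ≤ v ⬝ᵥ (M *ᵥ v)} := by
    ext M
    simp only [mem_setOf_eq, mem_inter_iff, mem_iInter, Matrix.posSemidef_iff_dotProduct_mulVec,
      star_trivial]
    rfl
  rw [h]
  refine IsClosed.inter (isClosed_eq continuous_id.matrix_conjTranspose continuous_id) ?_
  refine isClosed_iInter fun v => ?_
  exact isClosed_le continuous_const
    (Continuous.dotProduct continuous_const (continuous_id.matrix_mulVec continuous_const))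

/-- The fibre chart is continuous (affine). [folklore] -/
theorem continuous_rebitFibreDensity (D : Matrix (Fin 2) (Fin 2) ℝ) :
    Continuous (rebitFibreDensity D) := by
  refine continuous_matrix fun i j => ?_
  fin_cases i <;> fin_cases j <;> simp [rebitFibreDensity] <;> fun_prop

/-- The partial transpose of the fibre chart is continuous (affine). [folklore] -/
theorem continuous_rebitFibreDensityPT (D : Matrix (Fin 2) (Fin 2) ℝ) :
    Continuous (rebitFibreDensityPT D) := by
  refine continuous_matrix fun i j => ?_
  fin_cases i <;> fin_cases j <;> simp [rebitFibreDensityPT] <;> fun_prop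

/-- The fibre body is closed. [folklore] -/
theorem isClosed_rebitFibreBody (D : Matrix (Fin 2) (Fin 2) ℝ) : IsClosed (rebitFibreBody D) :=
  isClosed_setOf_posSemidef_fin_four.preimage (continuous_rebitFibreDensity D)

/-- The PPT fibre body is closed. [folklore] -/
theorem isClosed_rebitFibrePPTBody (D : Matrix (Fin 2) (Fin 2) ℝ) :
    IsClosed (rebitFibrePPTBody D) :=
  (isClosed_setOf_posSemidef_fin_four.preimage (continuous_rebitFibreDensity D)).inter
    (isClosed_setOf_posSemidef_fin_four.preimage (continuous_rebitFibreDensityPT D))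

/-- The fibre body is Lebesgue measurable. [folklore] -/
theorem measurableSet_rebitFibreBody (D : Matrix (Fin 2) (Fin 2) ℝ) :
    MeasurableSet (rebitFibreBody D) :=
  (isClosed_rebitFibreBody D).measurableSet

/-- The PPT fibre body is Lebesgue measurable. [folklore] -/
theorem measurableSet_rebitFibrePPTBody (D : Matrix (Fin 2) (Fin 2) ℝ) :
    MeasurableSet (rebitFibrePPTBody D) :=
  (isClosed_rebitFibrePPTBody D).measurableSet

/-! ### Fubini: integrate the block `X` first -/

/-- The measurable splitting `ℝ⁷ ≃ ℝ³ × ℝ⁴`, `x ↦ (a, k)` (block coordinates of `X` and of `Z`).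
[folklore] -/
def rebitSplit : (Fin 7 → ℝ) ≃ᵐ (Fin 3 → ℝ) × (Fin 4 → ℝ) :=
  (MeasurableEquiv.piCongrLeft (fun _ : Fin 7 => ℝ)
      (finSumFinEquiv (m := 3) (n := 4))).symm.trans
    (MeasurableEquiv.sumPiEquivProdPi fun _ : Fin 3 ⊕ Fin 4 => ℝ)

/-- The inverse splitting is `rebitJoin`. [folklore] -/
theorem rebitSplit_symm_apply (a : Fin 3 → ℝ) (k : Fin 4 → ℝ) :
    rebitSplit.symm (a, k) = rebitJoin a k := by
  funext i
  fin_cases i <;> rfl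

/-- The splitting preserves Lebesgue measure. [folklore] -/
theorem measurePreserving_rebitSplit :
    MeasurePreserving rebitSplit (volume : Measure (Fin 7 → ℝ))
      (volume : Measure ((Fin 3 → ℝ) × (Fin 4 → ℝ))) :=
  (volume_measurePreserving_sumPiEquivProdPi fun _ : Fin 3 ⊕ Fin 4 => ℝ).comp
    (MeasurePreserving.symm _
      (volume_measurePreserving_piCongrLeft (fun _ : Fin 7 => ℝ)
        (finSumFinEquiv (m := 3) (n := 4))))

/-- Fubini for a measurable subset of the chart: `λ₇(B) = ∫⁻ a, λ₄({k | (a, k) ∈ B})`.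
[folklore] -/
theorem volume_eq_lintegral_volume_slice {B : Set (Fin 7 → ℝ)} (hB : MeasurableSet B) :
    volume B = ∫⁻ a : Fin 3 → ℝ, volume {k : Fin 4 → ℝ | rebitJoin a k ∈ B} := by
  have h1 : volume B =
      (volume : Measure ((Fin 3 → ℝ) × (Fin 4 → ℝ))) (rebitSplit.symm ⁻¹' B) :=
    (measurePreserving_rebitSplit.symm.measure_preimage hB.nullMeasurableSet).symm
  rw [h1, Measure.volume_eq_prod, Measure.prod_apply (hB.preimage rebitSplit.symm.measurable)]
  refine lintegral_congr fun a => ?_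
  congr 1
  ext k
  simp only [mem_preimage, mem_setOf_eq, rebitSplit_symm_apply]

/-- **Fubini for the state body over `𝟙`**: `λ₇(D_ℝ(𝟙)) = ∫⁻ a, λ₄(S(a))`.
[cite: LovasAndai2017, §3 (proof of Theorem 1, "By Fubini's theorem")] -/
theorem volume_rebitFibreBody_one_eq_lintegral :
    volume (rebitFibreBody (1 : Matrix (Fin 2) (Fin 2) ℝ)) = ∫⁻ a, volume (rebitSlice a) :=
  volume_eq_lintegral_volume_slice (measurableSet_rebitFibreBody 1)

/-- **Fubini for the PPT body over `𝟙`**: `λ₇(P_ℝ(𝟙)) = ∫⁻ a, λ₄(S^Γ(a))`.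
[cite: LovasAndai2017, §3 (proof of Theorem 1, "By Fubini's theorem")] -/
theorem volume_rebitFibrePPTBody_one_eq_lintegral :
    volume (rebitFibrePPTBody (1 : Matrix (Fin 2) (Fin 2) ℝ)) =
      ∫⁻ a, volume (rebitPPTSlice a) :=
  volume_eq_lintegral_volume_slice (measurableSet_rebitFibrePPTBody 1)

/-! ### Slices over blocks with a negative diagonal entry are empty -/

/-- If `x0 < 0` the slice is empty (`ρ₀₀ = x0 ≥ 0` for `ρ ≽ 0`). [folklore] -/
theorem rebitSlice_eq_empty_of_fst_neg {a : Fin 3 → ℝ} (h : a 0 < 0) : rebitSlice a = ∅ := by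
  ext k
  simp only [rebitSlice, mem_setOf_eq, mem_empty_iff_false, iff_false]
  intro hk
  have h0 : 0 ≤ rebitFibreDensity 1 (rebitJoin a k) 0 0 := hk.diag_nonneg
  rw [rebitFibreDensity_one_rebitJoin] at h0
  simp at h0
  linarith

/-- If `x1 < 0` the slice is empty (`ρ₁₁ = x1 ≥ 0` for `ρ ≽ 0`). [folklore] -/
theorem rebitSlice_eq_empty_of_snd_neg {a : Fin 3 → ℝ} (h : a 1 < 0) : rebitSlice a = ∅ := by
  ext k
  simp only [rebitSlice, mem_setOf_eq, mem_empty_iff_false, iff_false]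
  intro hk
  have h0 : 0 ≤ rebitFibreDensity 1 (rebitJoin a k) 1 1 := hk.diag_nonneg
  rw [rebitFibreDensity_one_rebitJoin] at h0
  simp at h0
  linarith

/-- If `1 < x0` the slice is empty (`ρ₂₂ = 1 − x0 ≥ 0` for `ρ ≽ 0`). [folklore] -/
theorem rebitSlice_eq_empty_of_one_lt_fst {a : Fin 3 → ℝ} (h : 1 < a 0) : rebitSlice a = ∅ := by
  ext k
  simp only [rebitSlice, mem_setOf_eq, mem_empty_iff_false, iff_false]
  intro hk
  have h0 : 0 ≤ rebitFibreDensity 1 (rebitJoin a k) 2 2 := hk.diag_nonneg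
  rw [rebitFibreDensity_one_rebitJoin] at h0
  simp at h0
  linarith

/-- If `1 < x1` the slice is empty (`ρ₃₃ = 1 − x1 ≥ 0` for `ρ ≽ 0`). [folklore] -/
theorem rebitSlice_eq_empty_of_one_lt_snd {a : Fin 3 → ℝ} (h : 1 < a 1) : rebitSlice a = ∅ := by
  ext k
  simp only [rebitSlice, mem_setOf_eq, mem_empty_iff_false, iff_false]
  intro hk
  have h0 : 0 ≤ rebitFibreDensity 1 (rebitJoin a k) 3 3 := hk.diag_nonneg
  rw [rebitFibreDensity_one_rebitJoin] at h0
  simp at h0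
  linarith

/-! ### The operator-norm unit ball `𝔹` of real `2 × 2` matrices and the defect bodies -/

/-- **The operator-norm unit ball** `𝔹 = {K ∈ ℝ^{2×2} | 𝟙 − KᵀK ≽ 0}` (`= {‖K‖ ≤ 1}`,
Lovas–Andai's `𝔹_ℝ`, closed version; Lemma 3: `X*X < I ⇔ ‖X‖ < 1`), in the row-major
coordinates `matZ`. [cite: LovasAndai2017, §2 (Lemma 3 and the unit ball 𝔹_𝕂)] -/
def rebitOpBall : Set (Fin 4 → ℝ) :=
  {k | (1 - (matZ k)ᵀ * matZ k).PosSemidef}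

/-- **The defect body** `{K ∈ 𝔹 | (V_ε⁻¹ K V_ε)ᵀ ∈ 𝔹}`, `V_ε = diag(1, ε)`, so
`(V_ε⁻¹ K V_ε)ᵀ = [[k00, k10/ε], [ε k01, k11]]`; its volume is Lovas–Andai's
`χ₁(ε) = λ₄({X ∈ 𝔹 | ‖V_ε⁻¹ X V_ε‖ < 1})` (Definition 1; `𝔹` is invariant under transposition
and the boundary is null). [cite: LovasAndai2017, Definition 1 (χ_d)] -/
def rebitDefectBall (ε : ℝ) : Set (Fin 4 → ℝ) :=
  {k | k ∈ rebitOpBall ∧ ![k 0, k 2 / ε, ε * k 1, k 3] ∈ rebitOpBall}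

/-- `rebitDefectBall ε ⊆ 𝔹`. [cite: LovasAndai2017, Definition 1] -/
theorem rebitDefectBall_subset (ε : ℝ) : rebitDefectBall ε ⊆ rebitOpBall := fun _ h => h.1

/-- The bordered matrix `J(K) = [[𝟙, K], [Kᵀ, 𝟙]]` (the density `[[X, Z], [Zᵀ, 𝟙 − X]]` at
`X = 𝟙` rescaled), as a `4 × 4` literal. [folklore] -/
def rebitBallDensity (k : Fin 4 → ℝ) : Matrix (Fin 4) (Fin 4) ℝ :=
  !![1, 0, k 0, k 1; 0, 1, k 2, k 3; k 0, k 2, 1, 0; k 1, k 3, 0, 1]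

/-- `finSumFinEquiv (inl 0) = 0` in `Fin 4`. [folklore] -/
@[simp] theorem finSumFinEquiv_two_two_inl_zero :
    finSumFinEquiv (m := 2) (n := 2) (Sum.inl 0) = (0 : Fin 4) := rfl

/-- `finSumFinEquiv (inl 1) = 1` in `Fin 4`. [folklore] -/
@[simp] theorem finSumFinEquiv_two_two_inl_one :
    finSumFinEquiv (m := 2) (n := 2) (Sum.inl 1) = (1 : Fin 4) := rfl

/-- `finSumFinEquiv (inr 0) = 2` in `Fin 4`. [folklore] -/
@[simp] theorem finSumFinEquiv_two_two_inr_zero :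
    finSumFinEquiv (m := 2) (n := 2) (Sum.inr 0) = (2 : Fin 4) := rfl

/-- `finSumFinEquiv (inr 1) = 3` in `Fin 4`. [folklore] -/
@[simp] theorem finSumFinEquiv_two_two_inr_one :
    finSumFinEquiv (m := 2) (n := 2) (Sum.inr 1) = (3 : Fin 4) := rfl

/-- `J(K)` is the block matrix `fromBlocks 𝟙 K Kᴴ 𝟙` re-indexed by `Fin 2 ⊕ Fin 2 ≃ Fin 4`.
[folklore] -/
theorem rebitBallDensity_submatrix (k : Fin 4 → ℝ) :
    (rebitBallDensity k).submatrix (finSumFinEquiv (m := 2) (n := 2))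
        (finSumFinEquiv (m := 2) (n := 2)) =
      Matrix.fromBlocks 1 (matZ k) (matZ k)ᴴ 1 := by
  ext (i | i) (j | j) <;> fin_cases i <;> fin_cases j <;>
    simp [rebitBallDensity, matZ, Matrix.fromBlocks]

/-- **Schur complement form of the unit ball** (Lovas–Andai Lemma 1 with `D₁ = D₂ = 𝟙`):
`K ∈ 𝔹 ↔ J(K) = [[𝟙, K], [Kᵀ, 𝟙]] ≽ 0`. [cite: LovasAndai2017, Lemma 1] -/
theorem mem_rebitOpBall_iff (k : Fin 4 → ℝ) :
    k ∈ rebitOpBall ↔ (rebitBallDensity k).PosSemidef := by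
  letI : Invertible (1 : Matrix (Fin 2) (Fin 2) ℝ) := invertibleOne
  rw [← Matrix.posSemidef_submatrix_equiv (finSumFinEquiv (m := 2) (n := 2)),
    rebitBallDensity_submatrix, Matrix.PosDef.fromBlocks₁₁ (matZ k) 1 Matrix.PosDef.one,
    inv_one, Matrix.mul_one, Matrix.conjTranspose_eq_transpose_of_trivial]
  rfl

/-! ### Slices over a diagonal block `X = diag(l, m)`, `0 < l, m < 1` -/

/-- The diagonal scaling `k_ij ↦ √(lᵢ (1 − lⱼ)) k_ij` (`l₀ = l`, `l₁ = m`), i.e.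
`K ↦ Λ^{1/2} K (𝟙 − Λ)^{1/2}` for `Λ = diag(l, m)` — Lovas–Andai's substitution
`C = D₁^{1/2} X D₂^{1/2}`. [cite: LovasAndai2017, §3 (proof of Theorem 1)] -/
def rebitDiagScale (l m : ℝ) : (Fin 4 → ℝ) →ₗ[ℝ] (Fin 4 → ℝ) :=
  Matrix.toLin' (Matrix.diagonal
    ![Real.sqrt l * Real.sqrt (1 - l), Real.sqrt l * Real.sqrt (1 - m),
      Real.sqrt m * Real.sqrt (1 - l), Real.sqrt m * Real.sqrt (1 - m)])

/-- Unfolding of the diagonal scaling. [folklore] -/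
theorem rebitDiagScale_apply (l m : ℝ) (k : Fin 4 → ℝ) :
    rebitDiagScale l m k =
      ![Real.sqrt l * Real.sqrt (1 - l) * k 0, Real.sqrt l * Real.sqrt (1 - m) * k 1,
        Real.sqrt m * Real.sqrt (1 - l) * k 2, Real.sqrt m * Real.sqrt (1 - m) * k 3] := by
  ext i
  fin_cases i <;> simp [rebitDiagScale, Matrix.mulVec_diagonal]

/-- The Jacobian of the diagonal scaling is `det = l m (1 − l)(1 − m)` (`0 ≤ l, m ≤ 1`);
Lovas–Andai: "The Jacobian of this transform is `det(D₁)^d det(D₂)^d`".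
[cite: LovasAndai2017, §3 (proof of Theorem 1)] -/
theorem det_rebitDiagScale {l m : ℝ} (hl : 0 ≤ l) (hl1 : l ≤ 1) (hm : 0 ≤ m) (hm1 : m ≤ 1) :
    LinearMap.det (rebitDiagScale l m) = l * m * (1 - l) * (1 - m) := by
  rw [rebitDiagScale, LinearMap.det_toLin', Matrix.det_diagonal, Fin.prod_univ_four]
  simp only [Matrix.cons_val_zero, Matrix.cons_val_one, Matrix.cons_val]
  have h1 : Real.sqrt l * Real.sqrt l = l := Real.mul_self_sqrt hl
  have h2 : Real.sqrt m * Real.sqrt m = m := Real.mul_self_sqrt hm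
  have h3 : Real.sqrt (1 - l) * Real.sqrt (1 - l) = 1 - l := Real.mul_self_sqrt (by linarith)
  have h4 : Real.sqrt (1 - m) * Real.sqrt (1 - m) = 1 - m := Real.mul_self_sqrt (by linarith)
  linear_combination (Real.sqrt m * Real.sqrt m * (Real.sqrt (1 - l) * Real.sqrt (1 - l)) *
    (Real.sqrt (1 - m) * Real.sqrt (1 - m))) * h1 + (l * (Real.sqrt (1 - l) * Real.sqrt (1 - l)) *
    (Real.sqrt (1 - m) * Real.sqrt (1 - m))) * h2 + (l * m * (Real.sqrt (1 - m) *
    Real.sqrt (1 - m))) * h3 + (l * m * (1 - l)) * h4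

/-- The block-diagonal congruence factor `A ⊕ B = diag(√l, √m, √(1−l), √(1−m))`
(`A = Λ^{1/2}`, `B = (𝟙 − Λ)^{1/2}`). [folklore] -/
def rebitDiagG (l m : ℝ) : Matrix (Fin 4) (Fin 4) ℝ :=
  Matrix.diagonal ![Real.sqrt l, Real.sqrt m, Real.sqrt (1 - l), Real.sqrt (1 - m)]

/-- `A ⊕ B` is invertible for `0 < l, m < 1`. [folklore] -/
theorem isUnit_rebitDiagG {l m : ℝ} (hl : 0 < l) (hl1 : l < 1) (hm : 0 < m) (hm1 : m < 1) :
    IsUnit (rebitDiagG l m) := by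
  rw [Matrix.isUnit_iff_isUnit_det, rebitDiagG, Matrix.det_diagonal, Fin.prod_univ_four,
    isUnit_iff_ne_zero]
  simp only [Matrix.cons_val_zero, Matrix.cons_val_one, Matrix.cons_val]
  have h1 := Real.sqrt_pos.2 hl
  have h2 := Real.sqrt_pos.2 hm
  have h3 := Real.sqrt_pos.2 (sub_pos.2 hl1)
  have h4 := Real.sqrt_pos.2 (sub_pos.2 hm1)
  positivity

/-- Congruence by `A ⊕ B` preserves and reflects positive semidefiniteness (`0 < l, m < 1`).
[folklore] -/
theorem posSemidef_rebitDiagG_conj_iff {l m : ℝ} (hl : 0 < l) (hl1 : l < 1) (hm : 0 < m)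
    (hm1 : m < 1) (M : Matrix (Fin 4) (Fin 4) ℝ) :
    (rebitDiagG l m * M * rebitDiagG l m).PosSemidef ↔ M.PosSemidef := by
  have h := Matrix.IsUnit.posSemidef_star_right_conjugate_iff (x := M)
    (isUnit_rebitDiagG hl hl1 hm hm1)
  have hstar : star (rebitDiagG l m) = rebitDiagG l m := by
    rw [Matrix.star_eq_conjTranspose, rebitDiagG, Matrix.diagonal_conjTranspose]
    rfl
  rwa [hstar] at h

/-- **Block factorisation over a diagonal block**:
`[[Λ, A K B], [(A K B)ᵀ, 𝟙 − Λ]] = (A ⊕ B) · J(K) · (A ⊕ B)` for `Λ = diag(l, m)`,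
`A = Λ^{1/2}`, `B = (𝟙 − Λ)^{1/2}`, `0 ≤ l, m ≤ 1` — the matrix form of the Schur-complement
computation `𝟙 − (D₁^{-1/2} C D₂^{-1/2})* (D₁^{-1/2} C D₂^{-1/2})` in the proof of Theorem 1.
[cite: LovasAndai2017, §3 (proof of Theorem 1)] -/
theorem rebitFibreDensity_one_diag (l m : ℝ) (hl : 0 ≤ l) (hl1 : l ≤ 1) (hm : 0 ≤ m)
    (hm1 : m ≤ 1) (k : Fin 4 → ℝ) :
    rebitFibreDensity 1 (rebitJoin ![l, m, 0] (rebitDiagScale l m k)) =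
      rebitDiagG l m * rebitBallDensity k * rebitDiagG l m := by
  have h1 : Real.sqrt l * Real.sqrt l = l := Real.mul_self_sqrt hl
  have h2 : Real.sqrt m * Real.sqrt m = m := Real.mul_self_sqrt hm
  have h3 : Real.sqrt (1 - l) * Real.sqrt (1 - l) = 1 - l := Real.mul_self_sqrt (by linarith)
  have h4 : Real.sqrt (1 - m) * Real.sqrt (1 - m) = 1 - m := Real.mul_self_sqrt (by linarith)
  rw [rebitFibreDensity_one_rebitJoin, rebitDiagScale_apply]
  ext i j
  fin_cases i <;> fin_cases j <;>
    simp [rebitDiagG, rebitBallDensity, Matrix.mul_apply, Matrix.diagonal, h1, h2, h3, h4] <;>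
    ring

/-- The same factorisation for the partial transpose, with `K` replaced by
`(V_ε⁻¹ K V_ε)ᵀ = [[k00, k10/ε], [ε k01, k11]]`, `ε = √(l(1−m)) / √(m(1−l))` (`0 < l, m < 1`):
`[[Λ, (A K B)ᵀ], [A K B, 𝟙 − Λ]] = (A ⊕ B) · J((V_ε⁻¹ K V_ε)ᵀ) · (A ⊕ B)` — the second
Schur-complement condition `‖D₂^{-1/2} C D₁^{-1/2}‖ ≤ 1` of the proof of Theorem 1 rewritten as
`‖(V*)⁻¹ X V‖ ≤ 1`. [cite: LovasAndai2017, §3 (proof of Theorem 1)] -/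
theorem rebitFibreDensityPT_one_diag (l m : ℝ) (hl : 0 < l) (hl1 : l < 1) (hm : 0 < m)
    (hm1 : m < 1) (k : Fin 4 → ℝ) :
    rebitFibreDensityPT 1 (rebitJoin ![l, m, 0] (rebitDiagScale l m k)) =
      rebitDiagG l m *
        rebitBallDensity ![k 0, k 2 / (Real.sqrt l * Real.sqrt (1 - m) /
            (Real.sqrt m * Real.sqrt (1 - l))),
          Real.sqrt l * Real.sqrt (1 - m) / (Real.sqrt m * Real.sqrt (1 - l)) * k 1, k 3] *
        rebitDiagG l m := by
  have h1 : Real.sqrt l * Real.sqrt l = l := Real.mul_self_sqrt hl.le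
  have h2 : Real.sqrt m * Real.sqrt m = m := Real.mul_self_sqrt hm.le
  have h3 : Real.sqrt (1 - l) * Real.sqrt (1 - l) = 1 - l := Real.mul_self_sqrt (by linarith)
  have h4 : Real.sqrt (1 - m) * Real.sqrt (1 - m) = 1 - m := Real.mul_self_sqrt (by linarith)
  have h5 := Real.sqrt_pos.2 hl
  have h6 := Real.sqrt_pos.2 hm
  have h7 := Real.sqrt_pos.2 (sub_pos.2 hl1)
  have h8 := Real.sqrt_pos.2 (sub_pos.2 hm1)
  rw [rebitFibreDensityPT_one_rebitJoin, rebitDiagScale_apply]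
  ext i j
  fin_cases i <;> fin_cases j <;>
    simp [rebitDiagG, rebitBallDensity, Matrix.mul_apply, Matrix.diagonal, h1, h2, h3, h4] <;>
    field_simp

/-- **The slice over a diagonal block is the scaled unit ball**: for `0 < l, m < 1`,
`S(diag(l, m)) = (K ↦ Λ^{1/2} K (𝟙 − Λ)^{1/2}) '' 𝔹`.
[cite: LovasAndai2017, §3 (proof of Theorem 1)] -/
theorem rebitSlice_diag {l m : ℝ} (hl : 0 < l) (hl1 : l < 1) (hm : 0 < m) (hm1 : m < 1) :
    rebitSlice ![l, m, 0] = rebitDiagScale l m '' rebitOpBall := by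
  have h5 := Real.sqrt_pos.2 hl
  have h6 := Real.sqrt_pos.2 hm
  have h7 := Real.sqrt_pos.2 (sub_pos.2 hl1)
  have h8 := Real.sqrt_pos.2 (sub_pos.2 hm1)
  ext z
  constructor
  · intro hz
    set k : Fin 4 → ℝ := ![z 0 / (Real.sqrt l * Real.sqrt (1 - l)),
      z 1 / (Real.sqrt l * Real.sqrt (1 - m)), z 2 / (Real.sqrt m * Real.sqrt (1 - l)),
      z 3 / (Real.sqrt m * Real.sqrt (1 - m))] with hk_def
    have hkz : rebitDiagScale l m k = z := by
      rw [rebitDiagScale_apply]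
      ext i
      fin_cases i <;> simp [k] <;> field_simp
    refine ⟨k, ?_, hkz⟩
    rw [mem_rebitOpBall_iff, ← posSemidef_rebitDiagG_conj_iff hl hl1 hm hm1,
      ← rebitFibreDensity_one_diag l m hl.le hl1.le hm.le hm1.le, hkz]
    exact hz
  · rintro ⟨k, hk, rfl⟩
    show (rebitFibreDensity 1 (rebitJoin ![l, m, 0] (rebitDiagScale l m k))).PosSemidef
    rw [rebitFibreDensity_one_diag l m hl.le hl1.le hm.le hm1.le,
      posSemidef_rebitDiagG_conj_iff hl hl1 hm hm1]
    exact (mem_rebitOpBall_iff k).1 hk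

/-- **The PPT slice over a diagonal block is the scaled defect body**: for `0 < l, m < 1`,
`S^Γ(diag(l, m)) = (K ↦ Λ^{1/2} K (𝟙 − Λ)^{1/2}) '' rebitDefectBall ε`,
`ε = √(l(1−m)) / √(m(1−l))`. [cite: LovasAndai2017, §3 (proof of Theorem 1)] -/
theorem rebitPPTSlice_diag {l m : ℝ} (hl : 0 < l) (hl1 : l < 1) (hm : 0 < m) (hm1 : m < 1) :
    rebitPPTSlice ![l, m, 0] = rebitDiagScale l m ''
      rebitDefectBall (Real.sqrt l * Real.sqrt (1 - m) / (Real.sqrt m * Real.sqrt (1 - l))) := by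
  have h5 := Real.sqrt_pos.2 hl
  have h6 := Real.sqrt_pos.2 hm
  have h7 := Real.sqrt_pos.2 (sub_pos.2 hl1)
  have h8 := Real.sqrt_pos.2 (sub_pos.2 hm1)
  ext z
  constructor
  · intro hz
    set k : Fin 4 → ℝ := ![z 0 / (Real.sqrt l * Real.sqrt (1 - l)),
      z 1 / (Real.sqrt l * Real.sqrt (1 - m)), z 2 / (Real.sqrt m * Real.sqrt (1 - l)),
      z 3 / (Real.sqrt m * Real.sqrt (1 - m))] with hk_def
    have hkz : rebitDiagScale l m k = z := by
      rw [rebitDiagScale_apply]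
      ext i
      fin_cases i <;> simp [k] <;> field_simp
    refine ⟨k, ⟨?_, ?_⟩, hkz⟩
    · rw [mem_rebitOpBall_iff, ← posSemidef_rebitDiagG_conj_iff hl hl1 hm hm1,
        ← rebitFibreDensity_one_diag l m hl.le hl1.le hm.le hm1.le, hkz]
      exact hz.1
    · rw [mem_rebitOpBall_iff, ← posSemidef_rebitDiagG_conj_iff hl hl1 hm hm1,
        ← rebitFibreDensityPT_one_diag l m hl hl1 hm hm1, hkz]
      exact hz.2
  · rintro ⟨k, hk, rfl⟩
    show (rebitFibreDensity 1 (rebitJoin ![l, m, 0] (rebitDiagScale l m k))).PosSemidef ∧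
      (rebitFibreDensityPT 1 (rebitJoin ![l, m, 0] (rebitDiagScale l m k))).PosSemidef
    rw [rebitFibreDensity_one_diag l m hl.le hl1.le hm.le hm1.le,
      rebitFibreDensityPT_one_diag l m hl hl1 hm hm1,
      posSemidef_rebitDiagG_conj_iff hl hl1 hm hm1, posSemidef_rebitDiagG_conj_iff hl hl1 hm hm1]
    exact ⟨(mem_rebitOpBall_iff k).1 hk.1, (mem_rebitOpBall_iff _).1 hk.2⟩

/-- **Volume of the slice over a diagonal block**: for `0 < l, m < 1`,
`λ₄(S(diag(l, m))) = l m (1−l)(1−m) · λ₄(𝔹)` (Lovas–Andai: the inner integral equals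
`det(D₁D₂)^d χ_d(1)` without the PPT condition). [cite: LovasAndai2017, §3 (proof of Theorem 1) and Corollary 2 (proof)] -/
theorem volume_rebitSlice_diag {l m : ℝ} (hl : 0 < l) (hl1 : l < 1) (hm : 0 < m)
    (hm1 : m < 1) :
    volume (rebitSlice ![l, m, 0]) =
      ENNReal.ofReal (l * m * (1 - l) * (1 - m)) * volume rebitOpBall := by
  rw [rebitSlice_diag hl hl1 hm hm1, Measure.addHaar_image_linearMap,
    det_rebitDiagScale hl.le hl1.le hm.le hm1.le, abs_of_nonneg]
  have := sub_pos.2 hl1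
  have := sub_pos.2 hm1
  positivity

/-- **Volume of the PPT slice over a diagonal block**: for `0 < l, m < 1`,
`λ₄(S^Γ(diag(l, m))) = l m (1−l)(1−m) · λ₄(rebitDefectBall ε)`, `ε = √(l(1−m)) / √(m(1−l))`
(Lovas–Andai: the inner integral equals `det(D₁D₂)^d χ_d(σ(V))`).
[cite: LovasAndai2017, §3 (proof of Theorem 1)] -/
theorem volume_rebitPPTSlice_diag {l m : ℝ} (hl : 0 < l) (hl1 : l < 1) (hm : 0 < m)
    (hm1 : m < 1) :
    volume (rebitPPTSlice ![l, m, 0]) =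
      ENNReal.ofReal (l * m * (1 - l) * (1 - m)) *
        volume (rebitDefectBall
          (Real.sqrt l * Real.sqrt (1 - m) / (Real.sqrt m * Real.sqrt (1 - l)))) := by
  rw [rebitPPTSlice_diag hl hl1 hm hm1, Measure.addHaar_image_linearMap,
    det_rebitDiagScale hl.le hl1.le hm.le hm1.le, abs_of_nonneg]
  have := sub_pos.2 hl1
  have := sub_pos.2 hm1
  positivity

end Literature.InformationTheory.Entanglement

end
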